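import Summits.ABC.StewartYu.PadicG3PackClosedP
import Summits.ABC.StewartYu.PadicG3ClosedLogs
import HarnessLib

/-!
# Cell abc-stewartyu, crux `Y07Odd` (stmt-ABC-19658), line `gen3-slab-odd`: the SHARP half-point clearing — the Kummer half-step package
# `HalfStepHypU` from ONE inequality with the denominator `halfDen = ∏ den(αⱼ)^{2Lⱼ|s₁|}` and the size `halfHgtR = ∏ max(1,|αⱼ|)^{2Lⱼ|s₁|}`
# in place of `monDen(α, 2L|s₁|) = ∏ (|num αⱼ|·den αⱼ)^{2Lⱼ|s₁|}` (twice) and `monDen` (once)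

`Summits/ABC/StewartYu/PadicG3SupplyHalfSharp.lean` — cell `abc-stewartyu` (HOME `run/shared/lean/pub/abc-stewartyu/`), seat p5 (g4);
sequel to p2-g4's `PadicG3SupplyHalf` / `PadicG3PackClosedHalf` / `PadicG3PackClosedP`.  Definitions `halfDen`, `halfHgtR`, `DCs`, `MhCs` and
theorems; no named fact.

WHY (FLAG F5, STATUS 2026-08-27T05:26Z, numbers HOME/p5/census-halfstep/): the half-point monomial `qEhG α (rootExp L w s₁) = ∏ⱼ αⱼ^{⌊eⱼ/2⌋}`
has NATURAL exponents `⌊eⱼ/2⌋ ≤ halfEⱼ = 2Lⱼ|s₁|`, so it is cleared by `halfDen = ∏ⱼ den(αⱼ)^{halfEⱼ}` alone and has absolute value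
`≤ halfHgtR = ∏ⱼ max(1,|αⱼ|)^{halfEⱼ}`, with `log halfDen + log halfHgtR = Σⱼ halfEⱼ·h(αⱼ)`.  Per degree of the half-step Liouville
(`D/(4D²·Mb·hP³)^{2^{n+1}}`) the height of the box is then charged at most TWICE (`2·log halfDen + log halfHgtR ≤ 2·Σ halfEⱼ h(αⱼ)`; once for
integer `αⱼ`) instead of six times (`3·log monDen ≤ 6·Σ halfEⱼ h(αⱼ)` through `DC²·MhC`), which is what makes the record's half-step line
close with the printed box `|λⱼ| ≤ L/(2Aⱼ)` (R21-d) in both branches (census: cost/gain 1.10 → 0.62 at the binding case).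

* `halfDen`, `halfHgtR`, `one_le_halfDen`, `one_le_halfHgtR`, `log_halfDen_add_log_halfHgtR`, `log_halfDen_le`, `log_halfHgtR_le`;
* `exists_int_halfDen_mul_qEhG` (integrality), `abs_qEhG_le_halfHgtR` (size), **`htermW_clearSharp`**;
* closed forms `DCs = ν(H)^{t₀}·|b_{j₀}|^{|t|}·halfDen`, `MhCs = 2^{t₀}·M0C(lev+1)·XbC^{|t|}·halfHgtR`, and **`halfStepHypU_of_ineqSharp`** — the
  package `HalfStepHypU` for `lev < Ŝ` from `1 ≤ t`, `T′ + t ≤ T`, `1 ≤ H` and the single inequality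
  `max (BwP·‖Λ/b_{j₀}‖·p^{⌊(t−1)/2⌋}·p^{condExp}) (BwP/(p^m√p)^{(2N+1)t}) < DCs/(4·DCs²·(1 + #U·P·MhCs)·(∏H(α))³)^{2^{n+1}}`.

WHAT THIS IS NOT: no budget inequality (record); the k-step packages are unchanged (`kStepHypU_of_ineqP`); no crux moves.

References: Yu. V. Nesterenko, LNM 1819 (2003) §3.2 (heights of the values), §4.3; K. Yu, Compositio 74 (1990) Lemma 2.5;
K. Yu, Acta Math. 211 (2013) (5.35)–(5.39).
-/

noncomputable section

open NormedSpace Finset Polynomial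
open Literature.NumberTheory.Transcendental
open Literature.NumberTheory.Transcendental.PadicCW77 (condExp)
open Literature.NumberTheory.Transcendental.CW77.Setup (Tau tauNorm)
open scoped Nat

namespace Summit.ABC.StewartYu

namespace G3Setup

variable {p : ℕ} [Fact p.Prime] (S : G3Setup p)

/-! ### The sharp denominator and size of the half-point monomials -/

/-- The denominator of the half-point monomials: `halfDen L s₁ = ∏ⱼ den(αⱼ)^{2Lⱼ|s₁|}`. [cite: Nesterenko2003, §3.2; shape only] -/
def halfDen (L : Fin S.n → ℕ) (s₁ : ℤ) : ℕ := ∏ j, (S.α j).den ^ S.halfE L s₁ j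

/-- The size of the half-point monomials: `halfHgtR L s₁ = ∏ⱼ max(1, |αⱼ|)^{2Lⱼ|s₁|}`. [cite: Nesterenko2003, §3.2; shape only] -/
def halfHgtR (L : Fin S.n → ℕ) (s₁ : ℤ) : ℝ := ∏ j, (max 1 |(S.α j : ℝ)|) ^ S.halfE L s₁ j

/-- `1 ≤ halfDen`. [folklore] -/
theorem one_le_halfDen (L : Fin S.n → ℕ) (s₁ : ℤ) : 1 ≤ S.halfDen L s₁ := by
  unfold halfDen
  exact Finset.one_le_prod' fun j _ => Nat.one_le_pow _ _ (S.α j).den_pos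

/-- `1 ≤ halfHgtR`. [folklore] -/
theorem one_le_halfHgtR (L : Fin S.n → ℕ) (s₁ : ℤ) : 1 ≤ S.halfHgtR L s₁ := by
  unfold halfHgtR
  calc (1 : ℝ) = ∏ _j : Fin S.n, (1 : ℝ) := by simp
    _ ≤ ∏ j, (max 1 |(S.α j : ℝ)|) ^ S.halfE L s₁ j :=
        Finset.prod_le_prod (fun _ _ => zero_le_one) fun j _ => one_le_pow₀ (le_max_left _ _)

omit [Fact p.Prime] S in
/-- `den(q) · max(1, |q|) = max(|num q|, den q)` (real form). [folklore] -/
theorem den_mul_max_one_abs (q : ℚ) : (q.den : ℝ) * max 1 |(q : ℝ)| = ((max q.num.natAbs q.den : ℕ) : ℝ) := by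
  have hd : (0 : ℝ) < q.den := by exact_mod_cast q.den_pos
  have hq : (q : ℝ) = (q.num : ℝ) / (q.den : ℝ) := by
    rw [← Rat.num_div_den q]; push_cast; rw [Rat.num_div_den q]
  have habs : |(q : ℝ)| = (q.num.natAbs : ℝ) / (q.den : ℝ) := by
    rw [hq, abs_div, abs_of_pos hd, Nat.cast_natAbs, Int.cast_abs]
  rw [habs, Nat.cast_max]
  rcases le_total (q.num.natAbs : ℝ) (q.den : ℝ) with h | h
  · rw [max_eq_left ((div_le_one hd).mpr h), max_eq_right h, mul_one]
  · rw [max_eq_right ((one_le_div hd).mpr h), max_eq_left h, mul_div_cancel₀ _ hd.ne']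

/-- **`log halfDen + log halfHgtR = Σⱼ halfEⱼ · h(αⱼ)`** (`den · max(1,|α|) = max(|num|, den)`, `h = log max(|num|, den)`).
[cite: Nesterenko2003, §3.2; shape only] -/
theorem log_halfDen_add_log_halfHgtR (L : Fin S.n → ℕ) (s₁ : ℤ) :
    Real.log (S.halfDen L s₁ : ℝ) + Real.log (S.halfHgtR L s₁) = ∑ j, (S.halfE L s₁ j : ℝ) * Height.logHeight₁ (S.α j) := by
  have hpos : ∀ j, (0 : ℝ) < ((S.α j).den : ℝ) ^ S.halfE L s₁ j * (max 1 |(S.α j : ℝ)|) ^ S.halfE L s₁ j := fun j => by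
    have : (0 : ℝ) < (S.α j).den := by exact_mod_cast (S.α j).den_pos
    positivity
  have hprod : (S.halfDen L s₁ : ℝ) * S.halfHgtR L s₁ = ∏ j, (((max (S.α j).num.natAbs (S.α j).den : ℕ) : ℝ)) ^ S.halfE L s₁ j := by
    unfold halfDen halfHgtR
    push_cast
    rw [← Finset.prod_mul_distrib]
    refine Finset.prod_congr rfl fun j _ => ?_
    rw [← mul_pow, den_mul_max_one_abs (S.α j), Nat.cast_max]
  have h1 : (0 : ℝ) < (S.halfDen L s₁ : ℝ) := by exact_mod_cast S.one_le_halfDen L s₁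
  have h2 : (0 : ℝ) < S.halfHgtR L s₁ := lt_of_lt_of_le one_pos (S.one_le_halfHgtR L s₁)
  rw [← Real.log_mul h1.ne' h2.ne', hprod, Real.log_prod (s := Finset.univ) (fun j _ => ?_)]
  · refine Finset.sum_congr rfl fun j _ => ?_
    rw [Real.log_pow, Rat.logHeight₁_eq_log_max]
  · have : (1 : ℝ) ≤ ((max (S.α j).num.natAbs (S.α j).den : ℕ) : ℝ) := by exact_mod_cast le_max_of_le_right (S.α j).den_pos
    positivity

/-- `log halfHgtR ≤ Σⱼ halfEⱼ · h(αⱼ)`. [folklore] -/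
theorem log_halfHgtR_le (L : Fin S.n → ℕ) (s₁ : ℤ) :
    Real.log (S.halfHgtR L s₁) ≤ ∑ j, (S.halfE L s₁ j : ℝ) * Height.logHeight₁ (S.α j) := by
  rw [← S.log_halfDen_add_log_halfHgtR L s₁]
  have : 0 ≤ Real.log (S.halfDen L s₁ : ℝ) := Real.log_nonneg (by exact_mod_cast S.one_le_halfDen L s₁)
  linarith

/-- `log halfDen ≤ Σⱼ halfEⱼ · h(αⱼ)`. [folklore] -/
theorem log_halfDen_le (L : Fin S.n → ℕ) (s₁ : ℤ) :
    Real.log (S.halfDen L s₁ : ℝ) ≤ ∑ j, (S.halfE L s₁ j : ℝ) * Height.logHeight₁ (S.α j) := by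
  rw [← S.log_halfDen_add_log_halfHgtR L s₁]
  have : 0 ≤ Real.log (S.halfHgtR L s₁) := Real.log_nonneg (S.one_le_halfHgtR L s₁)
  linarith

/-- **`2·log halfDen + log halfHgtR ≤ 2·Σⱼ halfEⱼ · h(αⱼ)`** — the total height charge per degree of the half-step Liouville (`D²·Mb`).
[cite: Nesterenko2003, §3.2; shape only] -/
theorem two_mul_log_halfDen_add_le (L : Fin S.n → ℕ) (s₁ : ℤ) :
    2 * Real.log (S.halfDen L s₁ : ℝ) + Real.log (S.halfHgtR L s₁) ≤ 2 * ∑ j, (S.halfE L s₁ j : ℝ) * Height.logHeight₁ (S.α j) := by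
  have h1 := S.log_halfDen_add_log_halfHgtR L s₁
  have h2 := S.log_halfDen_le L s₁
  linarith

/-- `Σⱼ halfEⱼ·h(αⱼ) = 2|s₁|·Σⱼ Lⱼ h(αⱼ)`. [folklore] -/
theorem sum_halfE_mul_eq (L : Fin S.n → ℕ) (s₁ : ℤ) :
    ∑ j, (S.halfE L s₁ j : ℝ) * Height.logHeight₁ (S.α j) = 2 * |(s₁ : ℝ)| * ∑ j, (L j : ℝ) * Height.logHeight₁ (S.α j) := by
  rw [Finset.mul_sum]
  refine Finset.sum_congr rfl fun j _ => ?_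
  unfold halfE
  push_cast
  rw [Nat.cast_natAbs, Int.cast_abs]
  ring

/-! ### Integrality and size of the half-point monomial -/

omit [Fact p.Prime] S in
/-- `den(q)^E · q^e ∈ ℤ` for `e ≤ E`. [folklore] -/
theorem exists_int_den_pow_mul_pow (q : ℚ) {e E : ℕ} (he : e ≤ E) : ∃ z : ℤ, ((q.den ^ E : ℕ) : ℚ) * q ^ e = z := by
  refine ⟨(q.den : ℤ) ^ (E - e) * q.num ^ e, ?_⟩
  have hq : ((q.den : ℕ) : ℚ) * q = q.num := by rw [mul_comm]; exact Rat.mul_den_eq_num q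
  have hsplit : ((q.den ^ E : ℕ) : ℚ) = ((q.den : ℕ) : ℚ) ^ (E - e) * ((q.den : ℕ) : ℚ) ^ e := by
    push_cast; rw [← pow_add, Nat.sub_add_cancel he]
  rw [hsplit, mul_assoc, ← mul_pow, hq]
  push_cast; ring

omit [Fact p.Prime] S in
/-- `|q|^e ≤ max(1,|q|)^E` for `e ≤ E` (real). [folklore] -/
theorem abs_pow_le_max_pow (q : ℚ) {e E : ℕ} (he : e ≤ E) : |(q : ℝ)| ^ e ≤ (max 1 |(q : ℝ)|) ^ E :=
  (pow_le_pow_left₀ (abs_nonneg _) (le_max_right _ _) e).trans (pow_le_pow_right₀ (le_max_left _ _) he)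

/-- **The half-point monomial cleared by `halfDen`**: `halfDen · qEhG α (rootExp L w s₁) ∈ ℤ`. [cite: Nesterenko2003, §3.2; shape only] -/
theorem exists_int_halfDen_mul_qEhG {L : Fin S.n → ℕ} {w : Fin S.n → ℤ} (hw : ∀ j, |w j| ≤ (L j : ℤ)) (s₁ : ℤ) :
    ∃ z : ℤ, ((S.halfDen L s₁ : ℕ) : ℚ) * HalfMono.qEhG S.α (S.rootExp L w s₁) = z := by
  classical
  choose z hz using fun j => exists_int_den_pow_mul_pow (S.α j) (S.rootExp_div_two_le hw s₁ j)
  refine ⟨∏ j, z j, ?_⟩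
  unfold halfDen HalfMono.qEhG
  push_cast
  rw [← Finset.prod_mul_distrib]
  refine Finset.prod_congr rfl fun j _ => ?_
  have := hz j; push_cast at this; exact this

/-- **Size of the half-point monomial**: `|qEhG α (rootExp L w s₁)| ≤ halfHgtR L s₁`. [cite: Nesterenko2003, §3.2; shape only] -/
theorem abs_qEhG_le_halfHgtR {L : Fin S.n → ℕ} {w : Fin S.n → ℤ} (hw : ∀ j, |w j| ≤ (L j : ℤ)) (s₁ : ℤ) :
    |(HalfMono.qEhG S.α (S.rootExp L w s₁) : ℝ)| ≤ S.halfHgtR L s₁ := by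
  unfold HalfMono.qEhG halfHgtR
  push_cast
  rw [Finset.abs_prod]
  refine Finset.prod_le_prod (fun j _ => abs_nonneg _) fun j _ => ?_
  rw [abs_pow]
  exact abs_pow_le_max_pow (S.α j) (S.rootExp_div_two_le hw s₁ j)

/-! ### The class-sum terms, sharp form -/

/-- **Integrality and size of the half-step class-sum terms, SHARP form**: for `lev < Ŝ`, `H ≥ 1`, `|w_j| ≤ L_j`, `|𝔛(w)_k| ≤ Xb`, and
`M₀′ ≥ 2^{(Ŝ−lev−1)t₀} ν(H)^{t₀} e^{H/e} (e(1 + 2^{Ŝ−lev−1}|s₁|/H))^{ℓ₀}`: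
`D · htermW ∈ ℤ` with `D = ν(H)^{t₀}|b_{j₀}|^{|t|} halfDen(L, s₁)`, and `|htermW| ≤ 2^{t₀} M₀′ Xb^{|t|} halfHgtR(L, s₁)`.
[cite: Yu2013, (5.35)–(5.39); shape only] -/
theorem htermW_clearSharp {H Sh lev : ℕ} (hH : 1 ≤ H) (hlev : lev < Sh) (i : ℕ × (Fin S.n → ℤ)) {L : Fin S.n → ℕ}
    {w : Fin S.n → ℤ} (hw : ∀ j, |w j| ≤ (L j : ℤ)) (s₁ : ℤ) (τ : Tau S.n) {M₀' : ℤ}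
    (hM : (2 : ℝ) ^ ((Sh - (lev + 1)) * τ.1) * ((Nat.lcmUpto H : ℝ) ^ τ.1 *
      (Real.exp (H / Real.exp 1) * (Real.exp 1 * (1 + |((2 ^ (Sh - (lev + 1)) * s₁ : ℤ) : ℝ)| / H)) ^ i.1)) ≤ M₀')
    {Xb : ℤ} (hX : ∀ k, |S.𝔛 w k| ≤ Xb) :
    (∃ z : ℤ, (((Nat.lcmUpto H) ^ τ.1 * (S.b S.j₀).natAbs ^ (∑ k, τ.2 k) * S.halfDen L s₁ : ℕ) : ℚ) *
        S.htermW (S.Rl H Sh lev) L s₁ τ i w = z) ∧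
    |(S.htermW (S.Rl H Sh lev) L s₁ τ i w : ℝ)| ≤
      (2 : ℝ) ^ τ.1 * M₀' * (Xb : ℝ) ^ (∑ k, τ.2 k) * S.halfHgtR L s₁ := by
  obtain ⟨z₀, hz₀, hz₀le⟩ := S.exists_int_lcm_pow_mul_hasse_Rl hH Sh (lev + 1) i τ.1 s₁ hM
  obtain ⟨z₂, hz₂⟩ := S.exists_int_halfDen_mul_qEhG hw s₁
  set z₁ : ℤ := ∏ k, S.𝔛 w k ^ τ.2 k with hz₁
  have hz₁le : |z₁| ≤ Xb ^ (∑ k, τ.2 k) := by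
    rw [hz₁, Finset.abs_prod, ← Finset.prod_pow_eq_pow_sum]
    refine Finset.prod_le_prod (fun k _ => abs_nonneg _) fun k _ => ?_
    rw [abs_pow]; exact pow_le_pow_left₀ (abs_nonneg _) (hX k) _
  have hhalf := S.hasse_Rl_half (H := H) hlev i τ.1 s₁
  have hγ := S.natAbs_pow_mul_prod_zγ_pow w τ.2
  -- positivity of the clearing factors
  have hν : 1 ≤ Nat.lcmUpto H := Nat.lcmUpto_pos H
  have hb1 : 1 ≤ (S.b S.j₀).natAbs := Int.natAbs_pos.mpr S.bj₀_ne
  constructor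
  · refine ⟨2 ^ τ.1 * z₀ * ((S.b S.j₀).sign ^ (∑ k, τ.2 k) * z₁) * z₂, ?_⟩
    unfold htermW
    rw [hhalf]
    push_cast
    have e2 := hγ
    push_cast at e2 hz₀ hz₂
    calc ((Nat.lcmUpto H : ℚ)) ^ τ.1 * (((S.b S.j₀).natAbs : ℕ) : ℚ) ^ (∑ k, τ.2 k) * (S.halfDen L s₁ : ℚ) *
          (((2 : ℚ) ^ τ.1 * (hasseDeriv τ.1 (S.Rl H Sh (lev + 1) i)).eval (s₁ : ℚ) * (∏ k, S.zγ w k ^ τ.2 k)) *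
            HalfMono.qEhG S.α (S.rootExp L w s₁))
        = (2 : ℚ) ^ τ.1 * (((Nat.lcmUpto H : ℚ)) ^ τ.1 * (hasseDeriv τ.1 (S.Rl H Sh (lev + 1) i)).eval (s₁ : ℚ)) *
          ((((S.b S.j₀).natAbs : ℕ) : ℚ) ^ (∑ k, τ.2 k) * (∏ k, S.zγ w k ^ τ.2 k)) *
          ((S.halfDen L s₁ : ℚ) * HalfMono.qEhG S.α (S.rootExp L w s₁)) := by ring
      _ = (2 : ℚ) ^ τ.1 * (z₀ : ℚ) * (((S.b S.j₀).sign : ℚ) ^ (∑ k, τ.2 k) * (z₁ : ℚ)) * (z₂ : ℚ) := by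
          rw [hz₀, e2, hz₂, hz₁]; push_cast; ring
  · -- the size
    have hν0 : (0 : ℝ) < (Nat.lcmUpto H : ℝ) ^ τ.1 := by positivity
    have hb0 : (0 : ℝ) < (((S.b S.j₀).natAbs : ℕ) : ℝ) ^ (∑ k, τ.2 k) := by
      have : (0 : ℝ) < (((S.b S.j₀).natAbs : ℕ) : ℝ) := by exact_mod_cast hb1
      positivity
    -- the three factors
    have hA : |((((hasseDeriv τ.1 (S.Rl H Sh lev i)).eval ((s₁ : ℚ) / 2) : ℚ)) : ℝ)| ≤ (2 : ℝ) ^ τ.1 * M₀' := by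
      rw [hhalf]
      have h1 : |(((hasseDeriv τ.1 (S.Rl H Sh (lev + 1) i)).eval (s₁ : ℚ) : ℚ) : ℝ)| ≤ M₀' := by
        have hq : ((hasseDeriv τ.1 (S.Rl H Sh (lev + 1) i)).eval (s₁ : ℚ) : ℚ) = (z₀ : ℚ) / ((Nat.lcmUpto H) ^ τ.1 : ℕ) := by
          rw [eq_div_iff (by exact_mod_cast (pow_pos hν τ.1).ne'), mul_comm]; exact hz₀
        rw [hq]; push_cast
        rw [abs_div, abs_of_pos hν0, div_le_iff₀ hν0]
        have h0 : (0 : ℝ) ≤ M₀' := by exact_mod_cast (abs_nonneg _).trans hz₀le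
        calc |(z₀ : ℝ)| ≤ M₀' := by exact_mod_cast hz₀le
          _ = M₀' * 1 := (mul_one _).symm
          _ ≤ M₀' * (Nat.lcmUpto H : ℝ) ^ τ.1 := mul_le_mul_of_nonneg_left (one_le_pow₀ (by exact_mod_cast hν)) h0
      push_cast
      rw [abs_mul, abs_pow, abs_two]
      exact mul_le_mul_of_nonneg_left h1 (by positivity)
    have hB : |((∏ k, S.zγ w k ^ τ.2 k : ℚ) : ℝ)| ≤ (Xb : ℝ) ^ (∑ k, τ.2 k) := by
      have hq : (∏ k, S.zγ w k ^ τ.2 k : ℚ) = ((S.b S.j₀).sign : ℚ) ^ (∑ k, τ.2 k) * (z₁ : ℚ) / (((S.b S.j₀).natAbs ^ (∑ k, τ.2 k) : ℕ) : ℚ) := by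
        rw [eq_div_iff (by exact_mod_cast (pow_pos hb1 _).ne'), mul_comm]; exact hγ
      rw [hq]; push_cast
      rw [abs_div, abs_mul]
      have hs1 : |(((S.b S.j₀).sign : ℤ) : ℝ) ^ (∑ k, τ.2 k)| = 1 := by
        rw [abs_pow]
        have : |(((S.b S.j₀).sign : ℤ) : ℝ)| = 1 := by
          rcases lt_or_gt_of_ne S.bj₀_ne with h | h
          · rw [Int.sign_eq_neg_one_of_neg h]; norm_num
          · rw [Int.sign_eq_one_of_pos h]; norm_num
        rw [this, one_pow]
      rw [hs1, one_mul, abs_of_pos hb0, div_le_iff₀ hb0]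
      have hX0 : (0 : ℝ) ≤ (Xb : ℝ) ^ (∑ k, τ.2 k) := by exact_mod_cast (abs_nonneg _).trans hz₁le
      calc |(z₁ : ℝ)| ≤ (Xb : ℝ) ^ (∑ k, τ.2 k) := by exact_mod_cast hz₁le
        _ = (Xb : ℝ) ^ (∑ k, τ.2 k) * 1 := (mul_one _).symm
        _ ≤ (Xb : ℝ) ^ (∑ k, τ.2 k) * (((S.b S.j₀).natAbs : ℕ) : ℝ) ^ (∑ k, τ.2 k) :=
            mul_le_mul_of_nonneg_left (one_le_pow₀ (by exact_mod_cast hb1)) hX0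
    have hC : |(HalfMono.qEhG S.α (S.rootExp L w s₁) : ℝ)| ≤ S.halfHgtR L s₁ := S.abs_qEhG_le_halfHgtR hw s₁
    have hB' : |∏ k, ((S.zγ w k : ℚ) : ℝ) ^ τ.2 k| ≤ (Xb : ℝ) ^ (∑ k, τ.2 k) := by push_cast at hB; exact hB
    unfold htermW
    push_cast
    rw [abs_mul, abs_mul]
    have h2 : (0 : ℝ) ≤ (2 : ℝ) ^ τ.1 * M₀' := le_trans (abs_nonneg _) hA
    calc |((((hasseDeriv τ.1 (S.Rl H Sh lev i)).eval ((s₁ : ℚ) / 2) : ℚ)) : ℝ)| * |∏ k, ((S.zγ w k : ℚ) : ℝ) ^ τ.2 k| *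
          |(HalfMono.qEhG S.α (S.rootExp L w s₁) : ℝ)|
        ≤ ((2 : ℝ) ^ τ.1 * M₀') * (Xb : ℝ) ^ (∑ k, τ.2 k) * S.halfHgtR L s₁ := by
          refine mul_le_mul (mul_le_mul hA hB' (abs_nonneg _) h2) hC (abs_nonneg _) ?_
          exact mul_nonneg h2 ((abs_nonneg _).trans hB')
      _ = (2 : ℝ) ^ τ.1 * M₀' * (Xb : ℝ) ^ (∑ k, τ.2 k) * S.halfHgtR L s₁ := by ring

/-! ### The closed forms and the package from one inequality, sharp form -/

/-- The SHARP clearing denominator of the half-point class-sum terms: `ν(H)^{t₀} · |b_{j₀}|^{|t|} · halfDen(L, s₁)`. [folklore] -/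
def DCs (L : Fin S.n → ℕ) (H : ℕ) (s₁ : ℤ) (τ : Tau S.n) : ℕ :=
  (Nat.lcmUpto H) ^ τ.1 * (S.b S.j₀).natAbs ^ (∑ k, τ.2 k) * S.halfDen L s₁

/-- The SHARP size of the half-point class-sum terms: `2^{t₀} · M0C(lev+1) · XbC^{|t|} · halfHgtR(L, s₁)`. [folklore] -/
def MhCs (L : Fin S.n → ℕ) (L₀ H Sh lev : ℕ) (s₁ : ℤ) (τ : Tau S.n) : ℝ :=
  (2 : ℝ) ^ τ.1 * (M0C L₀ H Sh (lev + 1) s₁ τ.1 : ℝ) * (S.XbC L : ℝ) ^ (∑ k, τ.2 k) * S.halfHgtR L s₁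

/-- `1 ≤ DCs`. [folklore] -/
theorem one_le_DCs (L : Fin S.n → ℕ) (H : ℕ) (s₁ : ℤ) (τ : Tau S.n) : 1 ≤ S.DCs L H s₁ τ := by
  unfold DCs
  exact one_le_mul (one_le_mul (Nat.one_le_pow _ _ (Nat.lcmUpto_pos H)) (Nat.one_le_pow _ _ (Int.natAbs_pos.mpr S.bj₀_ne)))
    (S.one_le_halfDen L s₁)

/-- `0 ≤ MhCs`. [folklore] -/
theorem MhCs_nonneg (L : Fin S.n → ℕ) (L₀ H Sh lev : ℕ) (s₁ : ℤ) (τ : Tau S.n) : 0 ≤ S.MhCs L L₀ H Sh lev s₁ τ := by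
  unfold MhCs
  have hM : (0 : ℝ) ≤ M0C L₀ H Sh (lev + 1) s₁ τ.1 := by
    have h0 : (0 : ℤ) ≤ M0C L₀ H Sh (lev + 1) s₁ τ.1 := by unfold M0C; exact Int.ceil_nonneg (by positivity)
    exact_mod_cast h0
  have hX : (0 : ℝ) ≤ S.XbC L := by
    have h0 : (0 : ℤ) ≤ S.XbC L := by
      unfold XbC
      exact mul_nonneg (by norm_num) (mul_nonneg (sum_nonneg fun j _ => abs_nonneg _) (sum_nonneg fun j _ => by positivity))
    exact_mod_cast h0
  have hH : (0 : ℝ) ≤ S.halfHgtR L s₁ := le_trans zero_le_one (S.one_le_halfHgtR L s₁)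
  positivity

/-- **`HalfStepHypU` from one inequality, SHARP form** (`DCs`, `MhCs` in place of `DC`, `MhC`). [cite: Nesterenko2003, §4.3; shape only] -/
theorem halfStepHypU_of_ineqSharp {H Sh lev : ℕ} (hH : 1 ≤ H) (hlev : lev < Sh) (L₀ m : ℕ) (𝔏 : Finset (Fin S.n → ℤ)) (L : Fin S.n → ℕ)
    (P : ℤ) {N N₁ T T' t : ℕ} (ht : 1 ≤ t) (hT : T' + t ≤ T)
    (hineq : ∀ s₁ : ℤ, Odd s₁ → |s₁| ≤ (2 * N₁ - 1 : ℤ) → ∀ τ : Tau S.n, tauNorm τ + t ≤ T →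
      max (BwP (p := p) L₀ m * ‖S.Λ / (S.b S.j₀ : ℚ_[p])‖ * (p : ℝ) ^ ((t - 1) / 2) * (p : ℝ) ^ condExp p (2 * N + 1) t)
        (BwP (p := p) L₀ m / ((p : ℝ) ^ m * Real.sqrt p) ^ ((2 * N + 1) * t)) <
      (S.DCs L H s₁ τ : ℝ) / (4 * (S.DCs L H s₁ τ : ℝ) ^ 2 * (1 + ((S.unk L₀ 𝔏).card : ℝ) * P * S.MhCs L L₀ H Sh lev s₁ τ) *
        CW77.heightProd S.α ^ 3) ^ (2 ^ (S.n + 1))) :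
    S.HalfStepHypU (S.Rl H Sh lev) (S.Rl H Sh (lev + 1)) (S.unk L₀ 𝔏) L P m N N₁ T T' := by
  refine ⟨t, BwP (p := p) L₀ m, fun t₀ => (2 : ℚ) ^ t₀, fun s₁ τ => S.DCs L H s₁ τ, fun s₁ τ => S.MhCs L L₀ H Sh lev s₁ τ,
    ht, hT, BwP_nonneg L₀ m, S.hBw_closedP L₀ hH Sh lev m 𝔏, fun t₀ => pow_ne_zero _ two_ne_zero, ?_,
    fun s₁ τ => S.one_le_DCs L H s₁ τ, fun s₁ τ => S.MhCs_nonneg L L₀ H Sh lev s₁ τ, ?_, ?_, hineq⟩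
  · intro i _ t₀ s₁
    exact S.hasse_Rl_half (H := H) hlev i t₀ s₁
  · intro s₁ τ i hi w hw
    have hi1 : i.1 ≤ L₀ := by
      unfold unk at hi; have := (mem_product.mp hi).1; rw [mem_range] at this; omega
    have hM := S.M0C_spec (p := p) hH L₀ Sh (lev + 1) i hi1 s₁ τ.1
    exact (S.htermW_clearSharp hH hlev i hw s₁ τ hM (S.hXb_closed L w hw)).1
  · intro s₁ τ i hi w hw
    have hi1 : i.1 ≤ L₀ := by
      unfold unk at hi; have := (mem_product.mp hi).1; rw [mem_range] at this; omega
    have hM := S.M0C_spec (p := p) hH L₀ Sh (lev + 1) i hi1 s₁ τ.1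
    have h := (S.htermW_clearSharp hH hlev i hw s₁ τ hM (S.hXb_closed L w hw)).2
    unfold MhCs
    exact h

/-! ### The sizes of the sharp closed forms in the record's currency -/

/-- **`log DCs ≤ t₀·log ν(H) + |t|·W + 2|s₁|·Σⱼ Lⱼ h(αⱼ)`** (the `lcmUpto` kept symbolic: use `NWPi.log_lcmUpto_le` for `ψ(H) ≤ (23/20)H`).
[cite: Nesterenko2003, (3.26); shape only] -/
theorem log_DCs_le {W : ℝ} (hWb : ∀ j, Real.log (max 3 (|S.b j| : ℝ)) ≤ W) (L : Fin S.n → ℕ) (H : ℕ) (s₁ : ℤ) (τ : Tau S.n) :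
    Real.log (S.DCs L H s₁ τ : ℝ) ≤ τ.1 * Real.log (Nat.lcmUpto H : ℝ) + W * ∑ k, (τ.2 k : ℝ) +
      2 * |(s₁ : ℝ)| * ∑ j, (L j : ℝ) * Height.logHeight₁ (S.α j) := by
  have hν : (0 : ℝ) < (Nat.lcmUpto H : ℝ) := by exact_mod_cast Nat.lcmUpto_pos H
  have hb1 : (1 : ℝ) ≤ (((S.b S.j₀).natAbs : ℕ) : ℝ) := by exact_mod_cast Int.natAbs_pos.mpr S.bj₀_ne
  have hd1 : (1 : ℝ) ≤ (S.halfDen L s₁ : ℝ) := by exact_mod_cast S.one_le_halfDen L s₁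
  unfold DCs
  push_cast
  rw [Real.log_mul (by positivity) (by positivity), Real.log_mul (by positivity) (by positivity), Real.log_pow, Real.log_pow]
  have hb : Real.log (((S.b S.j₀).natAbs : ℕ) : ℝ) ≤ W := by
    have h := S.abs_b_le_exp hWb S.j₀
    rw [Nat.cast_natAbs, Int.cast_abs]
    have h3 : (0 : ℝ) < |((S.b S.j₀ : ℤ) : ℝ)| := by
      have : (S.b S.j₀ : ℝ) ≠ 0 := by exact_mod_cast S.bj₀_ne
      exact abs_pos.mpr this
    calc Real.log |((S.b S.j₀ : ℤ) : ℝ)| ≤ Real.log (Real.exp W) := Real.log_le_log h3 h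
      _ = W := Real.log_exp W
  have hsum0 : (0 : ℝ) ≤ ∑ k, (τ.2 k : ℝ) := sum_nonneg fun k _ => by positivity
  have h2 : (∑ k, τ.2 k : ℕ) * Real.log (((S.b S.j₀).natAbs : ℕ) : ℝ) ≤ W * ∑ k, (τ.2 k : ℝ) := by
    push_cast
    rw [mul_comm]
    exact mul_le_mul_of_nonneg_right hb hsum0
  have h3 := S.log_halfDen_le L s₁
  rw [S.sum_halfE_mul_eq] at h3
  linarith

/-- **`log halfHgtR ≤ 2|s₁|·Σⱼ Lⱼ h(αⱼ)`** and **`log halfDen + log halfHgtR = 2|s₁|·Σⱼ Lⱼ h(αⱼ)`**. [cite: Nesterenko2003, §3.2; shape only] -/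
theorem log_halfHgtR_le' (L : Fin S.n → ℕ) (s₁ : ℤ) :
    Real.log (S.halfHgtR L s₁) ≤ 2 * |(s₁ : ℝ)| * ∑ j, (L j : ℝ) * Height.logHeight₁ (S.α j) := by
  rw [← S.sum_halfE_mul_eq]; exact S.log_halfHgtR_le L s₁

/-- The combined charge: `log halfDen + log halfHgtR = 2|s₁|·Σⱼ Lⱼ h(αⱼ)`. [cite: Nesterenko2003, §3.2; shape only] -/
theorem log_halfDen_add_log_halfHgtR' (L : Fin S.n → ℕ) (s₁ : ℤ) :
    Real.log (S.halfDen L s₁ : ℝ) + Real.log (S.halfHgtR L s₁) = 2 * |(s₁ : ℝ)| * ∑ j, (L j : ℝ) * Height.logHeight₁ (S.α j) := by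
  rw [← S.sum_halfE_mul_eq]; exact S.log_halfDen_add_log_halfHgtR L s₁

end G3Setup

end Summit.ABC.StewartYu

end
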